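import Literature.MathematicalPhysics.QuantumLattice.SectorisedIncrementBoundGradedWeightedPlateau
import Literature.MathematicalPhysics.QuantumLattice.SectorisedIncrementBoundGradedPrescribedPlateau
import Literature.MathematicalPhysics.QuantumLattice.GrassmannWeightedEffectiveActionGradedTruncationPrescribedDB
import HarnessLib

/-!
# The orders `≥ 2` of the sectorised single-scale INCREMENT, GRADED, DECAY-WEIGHTED and with PRESCRIBED output legs, plateau transport
# (the weighted ALL-KNOWN track of the levels tower)

Topic `MathematicalPhysics/QuantumLattice`; the common twin of `SectorisedIncrementBoundGradedWeightedPlateau` (weight, one pinned leg) and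
`SectorisedIncrementBoundGradedPrescribedPlateau` (prescribed output legs, no weight).  The abstract supplier is ALREADY in the tree:
`GrassmannWeightedEffectiveActionGradedTruncationPrescribedDB.sum_wt_norm_kernel_effAction_sub_gaussConv_le_graded_prescribed_of_gramBounded` (orders
`2 ≤ n < N₀` of `effAction C V − e^{Δ_C}V`, one output leg pinned, the output legs `j ∈ J` constrained to predicates `A j`, the OTHER legs summed against a tree
weight `wt` of the output label set, graded terms AVERAGED over the landing profiles of the constrained legs, inputs through the `wt`-WEIGHTED anchored norms
`N(m′, F)` with `F` further legs constrained).  This file reads it through a substitution `f` and an analysis map `g` — the Young inequality must BOTH transport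
the prescription (a fine sector only overlaps its coarse parents, as in the prescribed door) AND thread the weight (`IsTreeWeight` sub-multiplicativity along the
legs, as in `GrassmannWeightedKernelYoung`) — and transports the result to the Hubbard torus by the plateau identities, the supplier's input hypothesis being
discharged from the COARSE-family WEIGHTED prescribed sizes of the input (weighted twin of `SectorisedKernelNormPrescribedBridge`).  Cell gate-hubbard-kl, K3 engine,
located item «(I2)-WT-ONCLASS» (plan g22 (R165)/(R167)): the `hstep` of the tower's WEIGHTED ALL-KNOWN array `klTowerBornWtFull`
(`…EngineTowerModelDefsWtFull`) — Benfatto–Giuliani–Mastropietro 2006 (2.61)–(2.63), (2.66), (2.70)–(2.71a), §2.8 (2.76)–(2.84), (2.88)–(2.90), App. A3 with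
the decay bookkeeping of §3 (3.2)–(3.8).

* §0 (generic) **`sum_filter_wt_norm_transform_prescribed_le`** / **`sum_filter_wt_norm_kernel_map_prescribed_le`** — Young's inequality for the multi-leg
  transform, one leg pinned, a set `J` of legs PRESCRIBED, output positions WEIGHTED: `Σ_{X′_p = w′, P j (X′_j)} wt(π′X′)·‖Σ_X (∏ M(X′_i,X_i)) K(X)‖ ≤ cr·cc^m·N_K`,
  `N_K` a bound on the `A`-constrained WEIGHTED pinned sums of `K`, weighted row/column sums `(cr, cc)`, compatibility `P j y′ ∧ M(y′,x) ≠ 0 ⇒ A j x`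
  (the prescribed door's §0 applied to the weighted data `‖K‖·wt`, `‖M‖·wt{·,·}` of the weighted Young file);
* §1 (generic label sets) **`sum_filter_wt_norm_kernel_map_effAction_sub_gaussConv_le_graded_prescribed_of_gramBounded`** — the supplier read through `(f, g)`;
* §2 (Hubbard torus) `sum_wt_norm_kernel_sectorPreimage_prescribedSlots_le_of_wt_prescribedSum_le` (the weighted prescribed bridge) and
  **`sum_filter_wt_norm_sectorAnalysis_effAction_sub_gaussConv_le_graded_prescribed_of_plateau`** — thin/fat input families `F, F̃`, output family `F′` in the
  plateau, `child`/parents (`ρc` per fine label), even `G` without constant part, WEIGHTED coarse-family prescribed sizes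
  `ε_x^{2m′−1} Σ_{σ′|_E = τ′|_E} Σ_{x′_q = y} wt(π(x′,σ′))·‖W_{F,σ′}(x′)‖ ≤ B m′ (|E|−1)`, weighted covariance row/column sums `≤ α`, weighted overlap costs `(cr, cc)`;
  then, one output leg pinned at `w″`, fine labels `τ″_j` prescribed on `j ∈ J`:
  `Σ_{X″_p = w″, (X″_j).2 = τ″_j} wt(π″X″)·‖kernel (map (toLin' E(F′)) (effAction C G − e^{Δ_C}G)) (m+1) X″‖ ≤ cr·cc^m·[graded-prescribed + tail](N(m′,F) := ρc^F·ε_x·B m′ F)`.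

Everything is proved; no definition, no named fact.  NOT here: the first order (weighted prescribed binomial–Gram, `GrassmannWeightedGaussConvBinomialGramPrescribed`
+ §0 + the same transport) and every model constant/count.

## Sources

G. Benfatto, A. Giuliani, V. Mastropietro, Ann. Henri Poincaré 7 (2006) 809–898, (2.61)–(2.63), (2.66), (2.70)–(2.71a), §2.8 (2.76)–(2.84), (2.88)–(2.90),
App. A3 Lemma A3.1, §3 (3.2)–(3.8) [`BenfattoGiulianiMastropietro2006`]; W. de Siqueira Pedra, M. Salmhofer, Comm. Math. Phys. 282 (2008) 797–818, Thm 1.3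
[`PedraSalmhofer2008`]; K. Gawȩdzki, A. Kupiainen, Comm. Math. Phys. 102 (1985) 1–30, §3 [`GawedzkiKupiainen1985GrossNeveu`].
-/

noncomputable section

namespace Literature.MathematicalPhysics.QuantumLattice

open GrassmannAlgebra Finset Literature.Probability.LatticeModels Literature.Probability.LatticeModels.BattleFederbush
open scoped Nat

universe u

/-! ### §0 Young's inequality for the multi-leg transform with PRESCRIBED legs and WEIGHTED positions -/

section Young

variable {𝕜 : Type*} [RCLike 𝕜] {Γ Γ' : Type*} {Λ : Type*} [Fintype Γ] [DecidableEq Γ] [Fintype Γ'] [DecidableEq Γ'] [DecidableEq Λ]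
  {wt : Finset Λ → ℝ}

/-- **Young's inequality for the multi-leg transform, one leg pinned, a set of legs PRESCRIBED, output positions WEIGHTED** (BGM 2006 (2.71a) with
§2.8 (2.88)–(2.90) and §3): positions `π : Γ → Λ`, `π′ : Γ′ → Λ`, a tree weight `wt`; `Mf` has WEIGHTED row sums `Σ_x ‖Mf y′ x‖·wt{π′y′, πx} ≤ cr` and column
sums `≤ cc`; the output legs `j ∈ J` are constrained to `P j` and `P j y′ ∧ Mf y′ x ≠ 0 ⇒ A j x`; the `A`-constrained WEIGHTED pinned sums of `K` (leg `p`) are `≤ N_K`.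
Then `Σ_{X′ : X′_p = w′, P j (X′_j) ∀ j ∈ J} wt(π′X′)·‖Σ_X (∏ᵢ Mf X′ᵢ Xᵢ) K X‖ ≤ cr · cc^m · N_K`.
[cite: BenfattoGiulianiMastropietro2006, (2.71a), (2.88)-(2.90), (3.2)-(3.8)] -/
theorem sum_filter_wt_norm_transform_prescribed_le (hwt : IsTreeWeight wt) (π : Γ → Λ) (π' : Γ' → Λ) {m : ℕ}
    (K : (Fin (m + 1) → Γ) → 𝕜) (Mf : Γ' → Γ → 𝕜) {cr cc : ℝ} (hcc0 : 0 ≤ cc)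
    (hrow : ∀ y', ∑ x, ‖Mf y' x‖ * wt {π' y', π x} ≤ cr) (hcol : ∀ x, ∑ y', ‖Mf y' x‖ * wt {π' y', π x} ≤ cc)
    (p : Fin (m + 1)) (J : Finset (Fin (m + 1))) (P : Fin (m + 1) → Γ' → Prop) [∀ j, DecidablePred (P j)]
    (A : Fin (m + 1) → Γ → Bool) (hPA : ∀ j ∈ J, ∀ (y' : Γ') (x : Γ), P j y' → Mf y' x ≠ 0 → A j x = true)
    {NK : ℝ} (hNK0 : 0 ≤ NK)
    (hK : ∀ x, ∑ X ∈ univ.filter (fun X : Fin (m + 1) → Γ => X p = x ∧ ∀ j ∈ J, A j (X j) = true),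
      ‖K X‖ * wt ((univ.image X).image π) ≤ NK) (w' : Γ') :
    ∑ X' ∈ univ.filter (fun X' : Fin (m + 1) → Γ' => X' p = w' ∧ ∀ j ∈ J, P j (X' j)), wt ((univ.image X').image π') *
        ‖∑ X : Fin (m + 1) → Γ, (∏ i, Mf (X' i) (X i)) * K X‖ ≤ cr * cc ^ m * NK := by
  -- the weighted kernel and matrix, as nonnegative reals in `𝕜` (as in `sum_filter_wt_norm_transform_le`)
  set Kw : (Fin (m + 1) → Γ) → 𝕜 := fun X => ((‖K X‖ * wt ((univ.image X).image π) : ℝ) : 𝕜) with hKw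
  set Mw : Γ' → Γ → 𝕜 := fun y' x => ((‖Mf y' x‖ * wt {π' y', π x} : ℝ) : 𝕜) with hMw
  have hKw_norm : ∀ X, ‖Kw X‖ = ‖K X‖ * wt ((univ.image X).image π) := fun X => by
    rw [hKw]; dsimp only
    rw [RCLike.norm_ofReal, abs_of_nonneg (mul_nonneg (norm_nonneg _) (hwt.nonneg _))]
  have hMw_norm : ∀ y' x, ‖Mw y' x‖ = ‖Mf y' x‖ * wt {π' y', π x} := fun y' x => by
    rw [hMw]; dsimp only
    rw [RCLike.norm_ofReal, abs_of_nonneg (mul_nonneg (norm_nonneg _) (hwt.nonneg _))]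
  -- the transform of the weighted data is a sum of nonnegative reals
  have hreal : ∀ X' : Fin (m + 1) → Γ', ∑ X : Fin (m + 1) → Γ, (∏ i, Mw (X' i) (X i)) * Kw X =
      ((∑ X : Fin (m + 1) → Γ, (∏ i, ‖Mf (X' i) (X i)‖ * wt {π' (X' i), π (X i)}) * (‖K X‖ * wt ((univ.image X).image π)) : ℝ) : 𝕜) := by
    intro X'
    rw [hKw, hMw]
    push_cast
    rfl
  have hnonneg : ∀ X' : Fin (m + 1) → Γ', 0 ≤ ∑ X : Fin (m + 1) → Γ, (∏ i, ‖Mf (X' i) (X i)‖ * wt {π' (X' i), π (X i)}) *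
      (‖K X‖ * wt ((univ.image X).image π)) := fun X' =>
    sum_nonneg fun X _ => mul_nonneg (prod_nonneg fun i _ => mul_nonneg (norm_nonneg _) (hwt.nonneg _))
      (mul_nonneg (norm_nonneg _) (hwt.nonneg _))
  -- pointwise domination of the weighted term by the transform of the weighted data
  have hpt : ∀ X' : Fin (m + 1) → Γ', wt ((univ.image X').image π') * ‖∑ X : Fin (m + 1) → Γ, (∏ i, Mf (X' i) (X i)) * K X‖ ≤
      ‖∑ X : Fin (m + 1) → Γ, (∏ i, Mw (X' i) (X i)) * Kw X‖ := by
    intro X'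
    rw [hreal, RCLike.norm_ofReal, abs_of_nonneg (hnonneg X')]
    refine (mul_le_mul_of_nonneg_left (norm_sum_le _ _) (hwt.nonneg _)).trans ?_
    rw [mul_sum]
    refine sum_le_sum fun X _ => ?_
    have hw : wt ((univ.image X').image π') ≤ wt ((univ.image X).image π) * ∏ i, wt {π' (X' i), π (X i)} := by
      rw [image_image, image_image]
      exact hwt.wt_image_le_mul_prod_pair _ (π' ∘ X') (π ∘ X) fun i => mem_image_of_mem _ (mem_univ i)
    rw [norm_mul, norm_prod]
    calc wt ((univ.image X').image π') * ((∏ i, ‖Mf (X' i) (X i)‖) * ‖K X‖)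
        ≤ (wt ((univ.image X).image π) * ∏ i, wt {π' (X' i), π (X i)}) * ((∏ i, ‖Mf (X' i) (X i)‖) * ‖K X‖) :=
          mul_le_mul_of_nonneg_right hw (mul_nonneg (prod_nonneg fun i _ => norm_nonneg _) (norm_nonneg _))
      _ = (∏ i, ‖Mf (X' i) (X i)‖ * wt {π' (X' i), π (X i)}) * (‖K X‖ * wt ((univ.image X).image π)) := by
          rw [prod_mul_distrib]; ring
  -- the prescribed, unweighted inequality for the weighted data
  have hrow' : ∀ y', ∑ x, ‖Mw y' x‖ ≤ cr := fun y' => by simp only [hMw_norm]; exact hrow y'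
  have hcol' : ∀ x, ∑ y', ‖Mw y' x‖ ≤ cc := fun x => by simp only [hMw_norm]; exact hcol x
  have hPA' : ∀ j ∈ J, ∀ (y' : Γ') (x : Γ), P j y' → Mw y' x ≠ 0 → A j x = true := by
    intro j hj y' x hPj hne
    refine hPA j hj y' x hPj fun h0 => hne ?_
    rw [hMw]; dsimp only
    rw [h0, norm_zero, zero_mul]
    push_cast
    rfl
  have hK' : ∀ x, ∑ X ∈ univ.filter (fun X : Fin (m + 1) → Γ => X p = x ∧ ∀ j ∈ J, A j (X j) = true), ‖Kw X‖ ≤ NK := fun x => by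
    simp only [hKw_norm]; exact hK x
  have h := sum_filter_norm_transform_prescribed_le Kw Mw hcc0 hrow' hcol' p J P A hPA' hNK0 hK' w'
  exact (sum_le_sum fun X' _ => hpt X').trans h

variable [Algebra ℚ 𝕜]

/-- **Substituting the legs, PRESCRIBED output legs, WEIGHTED output positions**: for a linear substitution `f` with matrix `M = toMatrix' f` (weighted row sums
`≤ cr`, weighted column sums `≤ cc`), output legs `j ∈ J` constrained to `P j`, input predicates `A j` with `P j y′ ∧ M y′ x ≠ 0 ⇒ A j x`, and `A`-constrained
weighted pinned sums of `kernel F (m+1)` bounded by `N_K`: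
`Σ_{X′ : X′_p = w′, P j (X′_j) ∀ j ∈ J} wt(π′X′)·‖kernel (map f F) (m+1) X′‖ ≤ cr · cc^m · N_K`. [cite: BenfattoGiulianiMastropietro2006, (2.71a), (2.88)-(2.90)] -/
theorem sum_filter_wt_norm_kernel_map_prescribed_le (hwt : IsTreeWeight wt) (π : Γ → Λ) (π' : Γ' → Λ) (f : (Γ → 𝕜) →ₗ[𝕜] (Γ' → 𝕜))
    {cr cc : ℝ} (hcc0 : 0 ≤ cc)
    (hrow : ∀ y', ∑ x, ‖LinearMap.toMatrix' f y' x‖ * wt {π' y', π x} ≤ cr)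
    (hcol : ∀ x, ∑ y', ‖LinearMap.toMatrix' f y' x‖ * wt {π' y', π x} ≤ cc)
    (F : GrassmannAlgebra 𝕜 Γ) (m : ℕ) (p : Fin (m + 1)) (J : Finset (Fin (m + 1))) (P : Fin (m + 1) → Γ' → Prop) [∀ j, DecidablePred (P j)]
    (A : Fin (m + 1) → Γ → Bool) (hPA : ∀ j ∈ J, ∀ (y' : Γ') (x : Γ), P j y' → LinearMap.toMatrix' f y' x ≠ 0 → A j x = true)
    {NK : ℝ} (hNK0 : 0 ≤ NK)
    (hK : ∀ x, ∑ X ∈ univ.filter (fun X : Fin (m + 1) → Γ => X p = x ∧ ∀ j ∈ J, A j (X j) = true),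
      ‖kernel 𝕜 F (m + 1) X‖ * wt ((univ.image X).image π) ≤ NK) (w' : Γ') :
    ∑ X' ∈ univ.filter (fun X' : Fin (m + 1) → Γ' => X' p = w' ∧ ∀ j ∈ J, P j (X' j)), wt ((univ.image X').image π') *
        ‖kernel 𝕜 (ExteriorAlgebra.map f F) (m + 1) X'‖ ≤ cr * cc ^ m * NK := by
  simp only [kernel_map]
  exact sum_filter_wt_norm_transform_prescribed_le hwt π π' _ _ hcc0 hrow hcol p J P A hPA hNK0 hK w'

end Young

/-! ### §1 Generic label sets: the weighted prescribed supplier read through `(f, g)` -/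

section Generic

variable {𝕜 : Type*} [RCLike 𝕜] {Γ Γ' Γ'' : Type u} {Λ : Type*} [Fintype Γ] [DecidableEq Γ] [Fintype Γ'] [DecidableEq Γ']
  [Fintype Γ''] [DecidableEq Γ''] [DecidableEq Λ] {wt : Finset Λ → ℝ}

/-- Nonnegativity of the graded-prescribed right side (helper, as in the prescribed door). [folklore] -/
private theorem gradedPrescribedRHS_nonneg' (Γ' : Type u) [Fintype Γ'] {κ α ρ : ℝ} (hκ : 0 < κ) (hα : 0 ≤ α) (hρ : 0 ≤ ρ) {m : ℕ}
    (J : Finset (Fin (m + 1))) (N : ℕ → ℕ → ℝ) (hN0 : ∀ m' F, 0 ≤ N m' F)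
    (hθ : Real.exp 1 * α * normV Γ' κ ρ (fun m' => N m' 0) / κ ^ 2 < 1) (N₀ : ℕ) :
    0 ≤ ∑ n ∈ Ico 2 N₀, (κ⁻¹ ^ (m + 1) * κ⁻¹ ^ (2 * (n - 1)) * (α ^ (n - 1) * Real.exp n)) *
          ∑ δ ∈ (Fintype.piFinset fun _ : Fin n => range (Fintype.card Γ' / 2 + 1)) with m + 1 + 2 * (n - 1) ≤ ∑ a, 2 * δ a,
            ∑ pf : J → Fin n, ((∏ j, ((2 * δ (pf j) : ℕ) : ℝ)) / ((∑ a, 2 * δ a : ℕ) : ℝ) ^ J.card) *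
              ∏ a, (Real.exp 3 * κ) ^ (2 * δ a) * N (δ a) (univ.filter fun j : J => pf j = a).card +
        ρ⁻¹ ^ (m + 1) * (Real.exp 1 * normV Γ' κ ρ (fun m' => N m' 0)) *
          (Real.exp 1 * α * normV Γ' κ ρ (fun m' => N m' 0) / κ ^ 2) ^ (N₀ - 1) /
            (1 - Real.exp 1 * α * normV Γ' κ ρ (fun m' => N m' 0) / κ ^ 2) := by
  have hV0 : 0 ≤ normV Γ' κ ρ (fun m' => N m' 0) := normV_nonneg hκ.le hρ fun m' => hN0 m' 0
  refine add_nonneg (sum_nonneg fun n _ => mul_nonneg (by positivity) (sum_nonneg fun δ _ => sum_nonneg fun pf _ =>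
    mul_nonneg (by positivity) (prod_nonneg fun a _ => mul_nonneg (by positivity) (hN0 _ _)))) ?_
  exact div_nonneg (by positivity) (by linarith)

/-- **The graded orders `≥ 2` with PRESCRIBED output legs and WEIGHTED output positions, read through `(f, g)`** (BGM 2006 (2.61)–(2.63), (2.66), (2.77)–(2.84),
(2.88)–(2.90), §3 (3.2)–(3.8)).  Data: a tree weight `wt` on `Finset Λ`, positions `π′ : Γ′ → Λ` (auxiliary fields), `π″ : Γ″ → Λ` (output labels); `Ṽ` even without constant
part on `Γ′`; `C′ = fᵀ C f` replica-Gram-bounded (`κ > 0`) with WEIGHTED row/column sums `Σ ‖C′(X,Y)‖·wt{π′X, π′Y} ≤ α`; output legs `j ∈ J` constrained to `P j`,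
predicates `A j` on `Γ′` inherited through the matrix of `g ∘ f`; the input through its `A`-constrained WEIGHTED anchored norms `N(m′, F)`; `θ < 1`; weighted costs
`(cr, cc)` of the matrix of `g ∘ f`; `N₀ ≥ 2`, `p ∉ J`.  Then
`Σ_{X″_p = w″, P j (X″_j)} wt(π″X″)·‖kernel_{m+1}(map g (effAction C (map f Ṽ) − e^{Δ_C}(map f Ṽ)))(X″)‖ ≤ cr·cc^m·[graded-prescribed + tail](N)`.
[cite: BenfattoGiulianiMastropietro2006, (2.61)-(2.63), (2.66), (2.84), (2.88)-(2.90), (3.2)-(3.8)] -/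
theorem sum_filter_wt_norm_kernel_map_effAction_sub_gaussConv_le_graded_prescribed_of_gramBounded
    (hwt : IsTreeWeight wt) (π' : Γ' → Λ) (π'' : Γ'' → Λ)
    (C : Matrix Γ Γ 𝕜) (f : (Γ' → 𝕜) →ₗ[𝕜] (Γ → 𝕜)) (g : (Γ → 𝕜) →ₗ[𝕜] (Γ'' → 𝕜))
    (Vt : GrassmannAlgebra 𝕜 Γ') (hVt : Vt ∈ evenPart 𝕜 Γ') (hVt0 : constPart 𝕜 Vt = 0)
    {κ : ℝ} (hκ : 0 < κ) (hGB : IsGramBoundedR ((LinearMap.toMatrix' f).transpose * C * LinearMap.toMatrix' f) κ)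
    {m : ℕ} (p : Fin (m + 1)) (J : Finset (Fin (m + 1))) (hp : p ∉ J) (P : Fin (m + 1) → Γ'' → Prop) [∀ j, DecidablePred (P j)]
    (A : Fin (m + 1) → Γ' → Bool)
    (hPA : ∀ j ∈ J, ∀ (y'' : Γ'') (x' : Γ'), P j y'' → (LinearMap.toMatrix' g * LinearMap.toMatrix' f) y'' x' ≠ 0 → A j x' = true)
    (N : ℕ → ℕ → ℝ) (hN0 : ∀ m' F, 0 ≤ N m' F)
    (hN : ∀ (m' : ℕ) (T : Finset (Fin (m + 1))), T ⊆ J → ∀ (ι : T → Fin (2 * m')), Function.Injective ι →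
      ∀ (t : Fin (2 * m')), (∀ j, ι j ≠ t) → ∀ a : Γ',
        ∑ Y ∈ univ.filter (fun Y : Fin (2 * m') → Γ' => Y t = a),
          ‖kernel 𝕜 Vt (2 * m') Y‖ * wt ((univ.image Y).image π') * ∏ j : T, (if A j (Y (ι j)) = true then (1 : ℝ) else 0) ≤ N m' T.card)
    {α : ℝ} (hα : 0 < α)
    (hrow : ∀ X, ∑ Y, ‖((LinearMap.toMatrix' f).transpose * C * LinearMap.toMatrix' f) X Y‖ * wt {π' X, π' Y} ≤ α)
    (hcol : ∀ Y, ∑ X, ‖((LinearMap.toMatrix' f).transpose * C * LinearMap.toMatrix' f) X Y‖ * wt {π' X, π' Y} ≤ α)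
    {ρ : ℝ} (hρ : 0 < ρ) (hθ : Real.exp 1 * α * normV Γ' κ ρ (fun m' => N m' 0) / κ ^ 2 < 1)
    {cr cc : ℝ} (hcc0 : 0 ≤ cc)
    (hrow' : ∀ X'', ∑ X', ‖(LinearMap.toMatrix' g * LinearMap.toMatrix' f) X'' X'‖ * wt {π'' X'', π' X'} ≤ cr)
    (hcol' : ∀ X', ∑ X'', ‖(LinearMap.toMatrix' g * LinearMap.toMatrix' f) X'' X'‖ * wt {π'' X'', π' X'} ≤ cc)
    {N₀ : ℕ} (hN₀ : 2 ≤ N₀) (w'' : Γ'') :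
    ∑ X'' ∈ univ.filter (fun X'' : Fin (m + 1) → Γ'' => X'' p = w'' ∧ ∀ j ∈ J, P j (X'' j)), wt ((univ.image X'').image π'') *
        ‖kernel 𝕜 (ExteriorAlgebra.map g
          (effAction 𝕜 C (ExteriorAlgebra.map f Vt) - gaussConv 𝕜 C (ExteriorAlgebra.map f Vt))) (m + 1) X''‖ ≤
      cr * cc ^ m *
        (∑ n ∈ Ico 2 N₀, (κ⁻¹ ^ (m + 1) * κ⁻¹ ^ (2 * (n - 1)) * (α ^ (n - 1) * Real.exp n)) *
            ∑ δ ∈ (Fintype.piFinset fun _ : Fin n => range (Fintype.card Γ' / 2 + 1)) with m + 1 + 2 * (n - 1) ≤ ∑ a, 2 * δ a,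
              ∑ pf : J → Fin n, ((∏ j, ((2 * δ (pf j) : ℕ) : ℝ)) / ((∑ a, 2 * δ a : ℕ) : ℝ) ^ J.card) *
                ∏ a, (Real.exp 3 * κ) ^ (2 * δ a) * N (δ a) (univ.filter fun j : J => pf j = a).card +
          ρ⁻¹ ^ (m + 1) * (Real.exp 1 * normV Γ' κ ρ (fun m' => N m' 0)) *
            (Real.exp 1 * α * normV Γ' κ ρ (fun m' => N m' 0) / κ ^ 2) ^ (N₀ - 1) /
              (1 - Real.exp 1 * α * normV Γ' κ ρ (fun m' => N m' 0) / κ ^ 2)) := by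
  set C' : Matrix Γ' Γ' 𝕜 := (LinearMap.toMatrix' f).transpose * C * LinearMap.toMatrix' f with hC'
  -- the weight pulled back to the auxiliary labels is a tree weight
  set wt' : Finset Γ' → ℝ := fun S => wt (S.image π') with hwt'
  have hwt'tree : IsTreeWeight wt' := hwt.comap π'
  have hpair : ∀ X Y : Γ', wt' {X, Y} = wt {π' X, π' Y} := fun X Y => by
    simp only [hwt', image_insert, image_singleton]
  have hrow₁ : ∀ X, ∑ Y, ‖C' X Y‖ * wt' {X, Y} ≤ α := fun X => by simpa only [hpair] using hrow X
  have hcol₁ : ∀ Y, ∑ X, ‖C' X Y‖ * wt' {X, Y} ≤ α := fun Y => by simpa only [hpair] using hcol Y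
  -- the weighted prescribed supplier in the auxiliary representation, for every pin
  have hK : ∀ a : Γ', ∑ W ∈ univ.filter (fun W : Fin (m + 1) → Γ' => W p = a ∧ ∀ j ∈ J, A j (W j) = true),
      ‖kernel 𝕜 (effAction 𝕜 C' Vt - gaussConv 𝕜 C' Vt) (m + 1) W‖ * wt ((univ.image W).image π') ≤
      ∑ n ∈ Ico 2 N₀, (κ⁻¹ ^ (m + 1) * κ⁻¹ ^ (2 * (n - 1)) * (α ^ (n - 1) * Real.exp n)) *
          ∑ δ ∈ (Fintype.piFinset fun _ : Fin n => range (Fintype.card Γ' / 2 + 1)) with m + 1 + 2 * (n - 1) ≤ ∑ a, 2 * δ a,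
            ∑ pf : J → Fin n, ((∏ j, ((2 * δ (pf j) : ℕ) : ℝ)) / ((∑ a, 2 * δ a : ℕ) : ℝ) ^ J.card) *
              ∏ a, (Real.exp 3 * κ) ^ (2 * δ a) * N (δ a) (univ.filter fun j : J => pf j = a).card +
        ρ⁻¹ ^ (m + 1) * (Real.exp 1 * normV Γ' κ ρ (fun m' => N m' 0)) *
          (Real.exp 1 * α * normV Γ' κ ρ (fun m' => N m' 0) / κ ^ 2) ^ (N₀ - 1) /
            (1 - Real.exp 1 * α * normV Γ' κ ρ (fun m' => N m' 0) / κ ^ 2) := by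
    intro a
    have h := sum_wt_norm_kernel_effAction_sub_gaussConv_le_graded_prescribed_of_gramBounded (C := C') hwt'tree hκ hGB Vt hVt hVt0 J A N hN0
      hN hα hrow₁ hcol₁ hρ hθ hN₀ (Nat.succ_pos m) p hp a
    exact le_of_eq_of_le (sum_congr rfl fun W _ => mul_comm _ _) h
  have hB0 := gradedPrescribedRHS_nonneg' Γ' hκ hα.le hρ.le J N hN0 hθ N₀
  -- read through `g ∘ f`
  have hsub : effAction 𝕜 C (ExteriorAlgebra.map f Vt) - gaussConv 𝕜 C (ExteriorAlgebra.map f Vt) =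
      ExteriorAlgebra.map f (effAction 𝕜 C' Vt - gaussConv 𝕜 C' Vt) := by
    rw [effAction_map, gaussConv_map, map_sub]
  rw [hsub, map_map_eq_map_comp]
  exact sum_filter_wt_norm_kernel_map_prescribed_le hwt π' π'' (g ∘ₗ f) hcc0
    (by intro X''; rw [LinearMap.toMatrix'_comp]; exact hrow' X'')
    (by intro X'; simp only [LinearMap.toMatrix'_comp]; exact hcol' X') (effAction 𝕜 C' Vt - gaussConv 𝕜 C' Vt) m p J P A
    (by intro j hj y'' x' hPj hne; rw [LinearMap.toMatrix'_comp] at hne; exact hPA j hj y'' x' hPj hne) hB0 hK w''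

end Generic

/-! ### §2 The Hubbard torus: the weighted prescribed bridge and the plateau transfer -/

section Transfer

variable {L M : ℕ} [NeZero L] [NeZero M] {N N' : ℕ} {Λ : Type*} [DecidableEq Λ] {wt : Finset Λ → ℝ}

omit [NeZero L] [NeZero M] in
/-- Expanding a product of set-membership indicators over the choices: `∏_{j} [v j ∈ P j] = Σ_{s ∈ Π_j P j} ∏_j [v j = s j]`. [folklore] -/
private theorem prod_ite_mem_eq_sum_prod_ite_eq' {ι₀ S : Type*} [Fintype ι₀] [DecidableEq ι₀] [DecidableEq S] (Par : ι₀ → Finset S) (v : ι₀ → S) :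
    (∏ j, (if v j ∈ Par j then (1 : ℝ) else 0)) = ∑ s ∈ Fintype.piFinset Par, ∏ j, (if v j = s j then (1 : ℝ) else 0) := by
  have h : ∀ j, (if v j ∈ Par j then (1 : ℝ) else 0) = ∑ y ∈ Par j, (if v j = y then (1 : ℝ) else 0) := fun j => by
    rw [Finset.sum_ite_eq]
  simp_rw [h]
  exact Finset.prod_univ_sum (fun j => Par j) (fun j y => if v j = y then (1 : ℝ) else 0)

omit [NeZero M] in
/-- **THE WEIGHTED PRESCRIBED BRIDGE** — discharging the supplier's input hypothesis for the sector preimage from the WEIGHTED sectorised prescribed sums: if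
for every leg set `E ∋ p` with `|E| = F + 1` and every prescription `τ`,
`ε_x^m Σ_{σ : σ|_E = τ|_E} Σ_{x : x_p = y} wl((x_i, σ_i)_i)·‖W_{F,σ}(x)‖ ≤ B` (`wl ≥ 0` a weight on the labelled position sets), then for every `T` with `|T| = F`,
injective `ι` missing `t`, prescribed labels `s` and pin `a`:
`Σ_{Y : Y t = a} ‖kernel (sectorPreimage β F G) (m+1) Y‖ · wl(Y) · ∏_{j : T} [ (Y (ι j)).2 = s j ] ≤ ε_x · B`
(the weighted twin of `sum_norm_kernel_sectorPreimage_prescribedSlots_le_of_prescribedSum_le`). [cite: BenfattoGiulianiMastropietro2006, §2.8 (2.88)-(2.90), App. A3 Lemma A3.1] -/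
theorem sum_wt_norm_kernel_sectorPreimage_prescribedSlots_le_of_wt_prescribedSum_le {ι₀ : Type*} {β : ℝ} (hβ : 0 ≤ β)
    (F : Fin N → FreqMomentum L M → ℂ) (G : HubbardGrassmann L M) (wl : Finset (SpaceTimeIdx L M × SectorLeg N) → ℝ) (hwl : ∀ S, 0 ≤ wl S)
    (m : ℕ) {Fc : ℕ} {B : ℝ}
    (hB : ∀ (E : Finset (Fin (m + 1))) (τ : Fin (m + 1) → SectorLeg N) (p : Fin (m + 1)), p ∈ E → E.card = Fc + 1 →
      ∀ y : SpaceTimeIdx L M,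
        imagTimeWeight β M ^ m * ∑ σ ∈ univ.filter (fun σ : Fin (m + 1) → SectorLeg N => ∀ e ∈ E, σ e = τ e),
          ∑ x ∈ univ.filter (fun x : Fin (m + 1) → SpaceTimeIdx L M => x p = y),
            wl (univ.image fun i => (x i, σ i)) * ‖sectorisedKernel L M β F G (m + 1) σ x‖ ≤ B)
    (T : Finset ι₀) (hT : T.card = Fc) (ι : T → Fin (m + 1)) (hι : Function.Injective ι) (t : Fin (m + 1)) (ht : ∀ j : T, ι j ≠ t)
    (s : T → SectorLeg N) (a : SpaceTimeIdx L M × SectorLeg N) :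
    ∑ Y ∈ univ.filter (fun Y : Fin (m + 1) → SpaceTimeIdx L M × SectorLeg N => Y t = a),
        ‖kernel ℂ (sectorPreimage β F G) (m + 1) Y‖ * wl (univ.image Y) * ∏ j : T, (if (Y (ι j)).2 = s j then (1 : ℝ) else 0) ≤
      imagTimeWeight β M * B := by
  classical
  have hε : 0 ≤ imagTimeWeight β M := imagTimeWeight_nonneg hβ M
  -- absorb the weight into the sectorised kernel (as a nonnegative real in `ℂ`)
  set W' : (Fin (m + 1) → SectorLeg N) → (Fin (m + 1) → SpaceTimeIdx L M) → ℂ :=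
    fun σ x => ((‖sectorisedKernel L M β F G (m + 1) σ x‖ * wl (univ.image fun i => (x i, σ i)) : ℝ) : ℂ) with hW'
  have hW'norm : ∀ σ x, ‖W' σ x‖ = wl (univ.image fun i => (x i, σ i)) * ‖sectorisedKernel L M β F G (m + 1) σ x‖ := by
    intro σ x
    rw [hW']; dsimp only
    rw [Complex.norm_real, Real.norm_of_nonneg (mul_nonneg (norm_nonneg _) (hwl _)), mul_comm]
  have hY : ∀ Y : Fin (m + 1) → SpaceTimeIdx L M × SectorLeg N,
      ‖kernel ℂ (sectorPreimage β F G) (m + 1) Y‖ * wl (univ.image Y) =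
        imagTimeWeight β M ^ (m + 1) * ‖W' (fun i => (Y i).2) (fun i => (Y i).1)‖ := by
    intro Y
    rw [kernel_sectorPreimage_eq_sectorisedKernel β F G (m + 1) Y, norm_mul, norm_pow, Complex.norm_real, Real.norm_of_nonneg hε, hW'norm]
    have himg : (univ.image fun i => ((Y i).1, (Y i).2)) = univ.image Y := by simp only [Prod.mk.eta]
    rw [himg]
    ring
  have hB' : ∀ (E : Finset (Fin (m + 1))) (τ : Fin (m + 1) → SectorLeg N) (p : Fin (m + 1)), p ∈ E → E.card = Fc + 1 →
      ∀ y : SpaceTimeIdx L M,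
        imagTimeWeight β M ^ m * ∑ σ ∈ univ.filter (fun σ : Fin (m + 1) → SectorLeg N => ∀ e ∈ E, σ e = τ e),
          ∑ x ∈ univ.filter (fun x : Fin (m + 1) → SpaceTimeIdx L M => x p = y), ‖W' σ x‖ ≤ B := by
    intro E τ p hp hE y
    simp only [hW'norm]
    exact hB E τ p hp hE y
  have hgen := sum_norm_prescribedSlots_le_of_prescribedSum_le (ε := imagTimeWeight β M) W' hB' T hT ι hι t ht s a
  calc ∑ Y ∈ univ.filter (fun Y : Fin (m + 1) → SpaceTimeIdx L M × SectorLeg N => Y t = a),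
        ‖kernel ℂ (sectorPreimage β F G) (m + 1) Y‖ * wl (univ.image Y) * ∏ j : T, (if (Y (ι j)).2 = s j then (1 : ℝ) else 0)
      = ∑ Y ∈ univ.filter (fun Y : Fin (m + 1) → SpaceTimeIdx L M × SectorLeg N => Y t = a),
          imagTimeWeight β M ^ (m + 1) * ‖W' (fun i => (Y i).2) (fun i => (Y i).1)‖ * ∏ j : T, (if (Y (ι j)).2 = s j then (1 : ℝ) else 0) :=
        sum_congr rfl fun Y _ => by rw [hY]
    _ = imagTimeWeight β M * (imagTimeWeight β M ^ m *
          ∑ Y ∈ univ.filter (fun Y : Fin (m + 1) → SpaceTimeIdx L M × SectorLeg N => Y t = a),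
            ‖W' (fun i => (Y i).2) (fun i => (Y i).1)‖ * ∏ j : T, (if (Y (ι j)).2 = s j then (1 : ℝ) else 0)) := by
        rw [mul_sum, mul_sum]
        exact sum_congr rfl fun Y _ => by ring
    _ ≤ imagTimeWeight β M * B := mul_le_mul_of_nonneg_left hgen hε

/-- **The orders `≥ 2` of the increment of the sectorised kernels across one slice, GRADED, PRESCRIBED output legs, WEIGHTED output positions — the weighted
ALL-KNOWN track** (BGM 2006 (2.61)–(2.63), (2.66), §2.8 (2.82)–(2.84), (2.88)–(2.90), App. A3 Lemma A3.1, §3 (3.2)–(3.8)).  Data: a tree weight `wt` on `Finset Λ`, position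
maps `π` (input labels) and `π″` (output labels); thin/fat input families `F, F̃` (`F̃F = F`, `ΣF = 0 ⇒ F = 0`), output family `F′` in the plateau of `F` over `supp C` and over
`F′`; `child` with the overlap matrix `E(F′)S(F̃)` vanishing unless the coarse label is a PARENT of the fine one, at most `ρc` parents per fine label; even `G` without
constant part whose COARSE-family WEIGHTED prescribed sizes are bounded: `ε_x^{2m′−1} Σ_{σ′|_E = τ|_E} Σ_{x′_q = y} wt(π(x′,σ′))·‖W_{F,σ′}(x′)‖ ≤ B m′ F` (`|E| = F+1 ∋ q`);
`S(F̃)ᵀ C S(F̃)` replica-Gram-bounded (`κ > 0`) with WEIGHTED row/column sums `≤ α`; `θ < 1` for the profile `m′ ↦ ρc⁰·(ε_x·B m′ 0)`; WEIGHTED overlap costs `(cr, cc)`;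
`N₀ ≥ 2`; output degree `m + 1`, leg `p` pinned at `w″`, legs `j ∈ J` (`p ∉ J`) prescribed to the fine labels `τ″ j`.  Then
`Σ_{X″_p = w″, (X″_j).2 = τ″_j} wt(π″X″)·‖kernel (map (toLin' E(F′)) (effAction C G − e^{Δ_C}G)) (m+1) X″‖ ≤ cr·cc^m·[graded-prescribed + tail](N)`,
`N(m′, F) := ρc^F·(ε_x·B m′ F)`. [cite: BenfattoGiulianiMastropietro2006, (2.61)-(2.63), (2.66), (2.84), (2.88)-(2.90), App. A3 Lemma A3.1, (3.2)-(3.8)] -/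
theorem sum_filter_wt_norm_sectorAnalysis_effAction_sub_gaussConv_le_graded_prescribed_of_plateau
    (hwt : IsTreeWeight wt) (π : SpaceTimeIdx L M × SectorLeg N → Λ) (π'' : SpaceTimeIdx L M × SectorLeg N' → Λ)
    {β : ℝ} (hβ : 0 < β) (F Ft : Fin N → FreqMomentum L M → ℂ) (hFF : ∀ ω k, Ft ω k * F ω k = F ω k)
    (hF0 : ∀ k, ∑ ω, F ω k = 0 → ∀ ω, F ω k = 0)
    (F' : Fin N' → FreqMomentum L M → ℂ) (G : HubbardGrassmann L M) (hG : G ∈ evenPart ℂ (HubbardFieldIdx L M))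
    (hG0 : constPart ℂ G = 0)
    (C : Matrix (HubbardFieldIdx L M) (HubbardFieldIdx L M) ℂ)
    (hCpl : ∀ X Y, C X Y ≠ 0 → ∑ ω, F ω X.1.1 = 1 ∧ ∑ ω, F ω Y.1.1 = 1)
    (hF'pl : ∀ (ω' : Fin N') (k : FreqMomentum L M), F' ω' k ≠ 0 → ∑ ω, F ω k = 1)
    (child : Fin N' → Fin N → Prop) [DecidableRel child]
    (hvan : ∀ (X'' : SpaceTimeIdx L M × SectorLeg N') (X' : SpaceTimeIdx L M × SectorLeg N),
      (sectorAnalysisMatrix L M β F' * sectorSubMatrix L M β Ft) X'' X' ≠ 0 →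
        child X''.2.1.1 X'.2.1.1 ∧ X'.2.1.2 = X''.2.1.2 ∧ X'.2.2 = X''.2.2)
    {ρc : ℝ} (hρc0 : 0 ≤ ρc)
    (hρc : ∀ ℓ'' : SectorLeg N',
      (((univ.filter fun ℓ' : SectorLeg N => child ℓ''.1.1 ℓ'.1.1 ∧ ℓ'.1.2 = ℓ''.1.2 ∧ ℓ'.2 = ℓ''.2).card : ℝ)) ≤ ρc)
    {κ : ℝ} (hκ : 0 < κ)
    (hGB : IsGramBoundedR ((sectorSubMatrix L M β Ft).transpose * C * sectorSubMatrix L M β Ft) κ)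
    (B : ℕ → ℕ → ℝ) (hB0 : ∀ m' Fc, 0 ≤ B m' Fc)
    (hB : ∀ (m' Fc : ℕ) (E : Finset (Fin (2 * m' + 1 + 1))) (τ : Fin (2 * m' + 1 + 1) → SectorLeg N) (q : Fin (2 * m' + 1 + 1)),
      q ∈ E → E.card = Fc + 1 → ∀ y : SpaceTimeIdx L M,
        imagTimeWeight β M ^ (2 * m' + 1) *
          ∑ σ ∈ univ.filter (fun σ : Fin (2 * m' + 1 + 1) → SectorLeg N => ∀ e ∈ E, σ e = τ e),
            ∑ x ∈ univ.filter (fun x : Fin (2 * m' + 1 + 1) → SpaceTimeIdx L M => x q = y),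
              wt ((univ.image fun i => (x i, σ i)).image π) * ‖sectorisedKernel L M β F G (2 * m' + 1 + 1) σ x‖ ≤ B (m' + 1) Fc)
    {α : ℝ} (hα : 0 < α)
    (hrow : ∀ X, ∑ Y, ‖((sectorSubMatrix L M β Ft).transpose * C * sectorSubMatrix L M β Ft) X Y‖ * wt {π X, π Y} ≤ α)
    (hcol : ∀ Y, ∑ X, ‖((sectorSubMatrix L M β Ft).transpose * C * sectorSubMatrix L M β Ft) X Y‖ * wt {π X, π Y} ≤ α)
    {ρ : ℝ} (hρ : 0 < ρ)
    (hθ : Real.exp 1 * α * normV (SpaceTimeIdx L M × SectorLeg N) κ ρ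
      (fun m' => ρc ^ 0 * (imagTimeWeight β M * B m' 0)) / κ ^ 2 < 1)
    {cr cc : ℝ} (hcc0 : 0 ≤ cc)
    (hrow' : ∀ X'', ∑ X', ‖(sectorAnalysisMatrix L M β F' * sectorSubMatrix L M β Ft) X'' X'‖ * wt {π'' X'', π X'} ≤ cr)
    (hcol' : ∀ X', ∑ X'', ‖(sectorAnalysisMatrix L M β F' * sectorSubMatrix L M β Ft) X'' X'‖ * wt {π'' X'', π X'} ≤ cc)
    {N₀ : ℕ} (hN₀ : 2 ≤ N₀) {m : ℕ} (p : Fin (m + 1)) (J : Finset (Fin (m + 1))) (hp : p ∉ J) (τ'' : Fin (m + 1) → SectorLeg N')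
    (w'' : SpaceTimeIdx L M × SectorLeg N') :
    ∑ X'' ∈ univ.filter (fun X'' : Fin (m + 1) → SpaceTimeIdx L M × SectorLeg N' => X'' p = w'' ∧ ∀ j ∈ J, (X'' j).2 = τ'' j),
        wt ((univ.image X'').image π'') *
          ‖kernel ℂ (ExteriorAlgebra.map (Matrix.toLin' (sectorAnalysisMatrix L M β F')) (effAction ℂ C G - gaussConv ℂ C G)) (m + 1) X''‖ ≤
      cr * cc ^ m *
        (∑ n ∈ Ico 2 N₀, (κ⁻¹ ^ (m + 1) * κ⁻¹ ^ (2 * (n - 1)) * (α ^ (n - 1) * Real.exp n)) *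
            ∑ δ ∈ (Fintype.piFinset fun _ : Fin n => range (Fintype.card (SpaceTimeIdx L M × SectorLeg N) / 2 + 1)) with
                m + 1 + 2 * (n - 1) ≤ ∑ a, 2 * δ a,
              ∑ pf : J → Fin n, ((∏ j, ((2 * δ (pf j) : ℕ) : ℝ)) / ((∑ a, 2 * δ a : ℕ) : ℝ) ^ J.card) *
                ∏ a, (Real.exp 3 * κ) ^ (2 * δ a) *
                  (ρc ^ (univ.filter fun j : J => pf j = a).card * (imagTimeWeight β M * B (δ a) (univ.filter fun j : J => pf j = a).card)) +
          ρ⁻¹ ^ (m + 1) * (Real.exp 1 * normV (SpaceTimeIdx L M × SectorLeg N) κ ρ (fun m' => ρc ^ 0 * (imagTimeWeight β M * B m' 0))) *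
            (Real.exp 1 * α * normV (SpaceTimeIdx L M × SectorLeg N) κ ρ (fun m' => ρc ^ 0 * (imagTimeWeight β M * B m' 0)) / κ ^ 2) ^
              (N₀ - 1) /
            (1 - Real.exp 1 * α * normV (SpaceTimeIdx L M × SectorLeg N) κ ρ (fun m' => ρc ^ 0 * (imagTimeWeight β M * B m' 0)) / κ ^ 2)) := by
  classical
  have hε : 0 ≤ imagTimeWeight β M := imagTimeWeight_nonneg hβ.le M
  -- the pulled-back weight on labelled positions is nonnegative
  have hwl : ∀ S : Finset (SpaceTimeIdx L M × SectorLeg N), 0 ≤ wt (S.image π) := fun S => zero_le_one.trans (hwt.one_le _)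
  -- the parents of a fine label and the inherited predicates
  set Par : SectorLeg N' → Finset (SectorLeg N) :=
    fun ℓ'' => univ.filter fun ℓ' : SectorLeg N => child ℓ''.1.1 ℓ'.1.1 ∧ ℓ'.1.2 = ℓ''.1.2 ∧ ℓ'.2 = ℓ''.2 with hPar
  set A : Fin (m + 1) → SpaceTimeIdx L M × SectorLeg N → Bool := fun j X' => decide (X'.2 ∈ Par (τ'' j)) with hA
  set Np : ℕ → ℕ → ℝ := fun m' Fc => ρc ^ Fc * (imagTimeWeight β M * B m' Fc) with hNp
  have hNp0 : ∀ m' Fc, 0 ≤ Np m' Fc := fun m' Fc => mul_nonneg (pow_nonneg hρc0 _) (mul_nonneg hε (hB0 _ _))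
  -- the supplier's input hypothesis for the preimage `Ṽ = sectorPreimage β F G`, discharged from `hB` (weighted bridge + parent-set expansion)
  have hN : ∀ (m' : ℕ) (T : Finset (Fin (m + 1))), T ⊆ J → ∀ (ι : T → Fin (2 * m')), Function.Injective ι →
      ∀ (t : Fin (2 * m')), (∀ j, ι j ≠ t) → ∀ a : SpaceTimeIdx L M × SectorLeg N,
        ∑ Y ∈ univ.filter (fun Y : Fin (2 * m') → SpaceTimeIdx L M × SectorLeg N => Y t = a),
          ‖kernel ℂ (sectorPreimage β F G) (2 * m') Y‖ * wt ((univ.image Y).image π) *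
            ∏ j : T, (if A j (Y (ι j)) = true then (1 : ℝ) else 0) ≤ Np m' T.card := by
    intro m' T _
    rcases m' with _ | m'
    · intro ι _ t
      exact Fin.elim0 (Fin.cast (Nat.mul_zero 2) t)
    · rw [show 2 * (m' + 1) = 2 * m' + 1 + 1 by ring]
      intro ι hι t ht a
      -- rewrite the inherited indicator as a sum over parent choices
      have hind : ∀ Y : Fin (2 * m' + 1 + 1) → SpaceTimeIdx L M × SectorLeg N,
          (∏ j : T, (if A j (Y (ι j)) = true then (1 : ℝ) else 0)) =
            ∑ s ∈ Fintype.piFinset (fun j : T => Par (τ'' j)), ∏ j : T, (if (Y (ι j)).2 = s j then (1 : ℝ) else 0) := by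
        intro Y
        rw [← prod_ite_mem_eq_sum_prod_ite_eq' (fun j : T => Par (τ'' j)) (fun j : T => (Y (ι j)).2)]
        refine prod_congr rfl fun j _ => ?_
        simp only [hA, decide_eq_true_eq]
      simp_rw [hind, mul_sum]
      rw [sum_comm]
      -- each parent choice is a single-label prescription: the weighted bridge
      have hone : ∀ s ∈ Fintype.piFinset (fun j : T => Par (τ'' j)),
          ∑ Y ∈ univ.filter (fun Y : Fin (2 * m' + 1 + 1) → SpaceTimeIdx L M × SectorLeg N => Y t = a),
            ‖kernel ℂ (sectorPreimage β F G) (2 * m' + 1 + 1) Y‖ * wt ((univ.image Y).image π) *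
              ∏ j : T, (if (Y (ι j)).2 = s j then (1 : ℝ) else 0) ≤
            imagTimeWeight β M * B (m' + 1) T.card := fun s _ =>
        sum_wt_norm_kernel_sectorPreimage_prescribedSlots_le_of_wt_prescribedSum_le hβ.le F G (fun S => wt (S.image π)) hwl (2 * m' + 1)
          (Fc := T.card) (B := B (m' + 1) T.card) (fun E τ q hq hE y => hB m' T.card E τ q hq hE y) T rfl ι hι t ht s a
      refine (sum_le_sum hone).trans ?_
      rw [sum_const, nsmul_eq_mul, Fintype.card_piFinset]
      have hcard : ((∏ j : T, (Par (τ'' j)).card : ℕ) : ℝ) ≤ ρc ^ T.card := by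
        rw [Nat.cast_prod, ← Fintype.card_coe T, ← Finset.card_univ, ← prod_const]
        exact prod_le_prod (fun j _ => Nat.cast_nonneg _) fun j _ => hρc (τ'' j)
      exact mul_le_mul_of_nonneg_right hcard (mul_nonneg hε (hB0 _ _))
  -- the inherited predicates: a fine label only overlaps its parents
  have hPA : ∀ j ∈ J, ∀ (y'' : SpaceTimeIdx L M × SectorLeg N') (x' : SpaceTimeIdx L M × SectorLeg N),
      (fun (j : Fin (m + 1)) (X'' : SpaceTimeIdx L M × SectorLeg N') => X''.2 = τ'' j) j y'' →
        (LinearMap.toMatrix' (Matrix.toLin' (sectorAnalysisMatrix L M β F')) *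
            LinearMap.toMatrix' (Matrix.toLin' (sectorSubMatrix L M β Ft))) y'' x' ≠ 0 → A j x' = true := by
    intro j _ y'' x' hPj hne
    rw [LinearMap.toMatrix'_toLin', LinearMap.toMatrix'_toLin'] at hne
    obtain ⟨h1, h2, h3⟩ := hvan y'' x' hne
    have hPj' : y''.2 = τ'' j := hPj
    simp only [hA, hPar, decide_eq_true_eq, mem_filter, mem_univ, true_and, ← hPj']
    exact ⟨h1, h2, h3⟩
  -- transfer from `map S Ṽ` to `G` (plateau identities)
  have hea := map_sectorAnalysis_effAction_map_sectorPreimage_of_plateau hβ.ne' F Ft hFF hF0 F' G C hCpl hF'pl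
  have hgc := map_sectorAnalysis_gaussConv_map_sectorPreimage_of_plateau hβ.ne' F Ft hFF hF0 F' G C hCpl hF'pl
  have hrepl : ExteriorAlgebra.map (Matrix.toLin' (sectorAnalysisMatrix L M β F')) (effAction ℂ C G - gaussConv ℂ C G) =
      ExteriorAlgebra.map (Matrix.toLin' (sectorAnalysisMatrix L M β F'))
        (effAction ℂ C (ExteriorAlgebra.map (Matrix.toLin' (sectorSubMatrix L M β Ft)) (sectorPreimage β F G)) -
          gaussConv ℂ C (ExteriorAlgebra.map (Matrix.toLin' (sectorSubMatrix L M β Ft)) (sectorPreimage β F G))) := by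
    rw [map_sub, map_sub, hea, hgc]
  rw [hrepl]
  exact sum_filter_wt_norm_kernel_map_effAction_sub_gaussConv_le_graded_prescribed_of_gramBounded hwt π π'' C
    (Matrix.toLin' (sectorSubMatrix L M β Ft)) (Matrix.toLin' (sectorAnalysisMatrix L M β F')) (sectorPreimage β F G)
    (sectorPreimage_mem_evenPart β F hG) (by rw [constPart_sectorPreimage, hG0]) hκ (by simpa only [LinearMap.toMatrix'_toLin'] using hGB)
    p J hp (fun j X'' => X''.2 = τ'' j) A hPA Np hNp0 hN hα (by simpa only [LinearMap.toMatrix'_toLin'] using hrow)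
    (by simpa only [LinearMap.toMatrix'_toLin'] using hcol) hρ hθ hcc0 (by simpa only [LinearMap.toMatrix'_toLin'] using hrow')
    (by simpa only [LinearMap.toMatrix'_toLin'] using hcol') hN₀ w''

end Transfer

end Literature.MathematicalPhysics.QuantumLattice

end
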